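import Literature.NumberTheory.GaloisRepresentations.ProfiniteIntersectionCocycleExtension
import Literature.NumberTheory.GaloisRepresentations.AbsGaloisGroupCompact
import Literature.NumberTheory.EllipticCurves.Kato2004.IwasawaH1ReductionInfty
import Literature.NumberTheory.EllipticCurves.Kato2004.LocalIwasawaCohomology
import Literature.NumberTheory.EllipticCurves.CyclotomicLayerPairingOfFun
import Literature.NumberTheory.EllipticCurves.SelmerCocycleLiftUnramifiedFiniteProofs
import Literature.NumberTheory.GaloisRepresentations.ContinuousH1AddHomAlgebraProofs
import Literature.NumberTheory.EllipticCurves.GreenbergSelmerCofreeTorsionGaloisModule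
import HarnessLib

/-!
# Sketch (stub-ideation k2 g17, `stub_cmLambdaLower`, crux stmt-BirchSwinnertonDyer-26074) — the kernel sockets of
# seam (c) of the AwayTwo frame: `H¹(U_∞, A) = lim→ₙ H¹(U_n, A)` for the LOCAL layer tower, and the character glue

BSD is NOT proved by anything here; RSL_g (stmt-22608) and (R≥)ᵖ (stmt-26074) stay OPEN.  No curve, no form, no
pairing value is asserted: §1 is continuous group cohomology of a profinite group (Serre, *Galois Cohomology* I §2.2
Prop. 8, `H^q(lim← Gᵢ, lim→ Aᵢ) = lim→ H^q(Gᵢ, Aᵢ)`, degree `q = 1`, group direction), §2 its instantiation on the local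
tower `U_n = layerGroup κ v n ↘ U_∞ = localSubgroupOfEmb κ.kerSubgroup (closureEmb ℚ_v)` of the frame
`Cruxes/ResidualSignedLambdaLowerCMAtTwo/AWAYTWO-FRAME-g18.md` §1 (generic discrete module `M`, any prime `p`), §3 the
pure-algebra glue «a directed family of level characters, compatible along the transitions, on a group EXHAUSTED by the
level images with the KERNEL CRITERION, is ONE character, uniquely» (existence + uniqueness of the frame's `locdS x w c`).

Typed dictionary (print ↦ tree socket ↦ frame object):
* `Gᵢ` (Serre)            ↦ `T n : Subgroup G`, antitone, open      ↦ `layerGroup κ w n`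
* `lim← Gᵢ = ⋂ Gᵢ`        ↦ `H` with `hle : ∀ n, H ≤ T n`, `hH`      ↦ `U∞ w` (`uInf_le_layerGroup`, `mem_uInf_of_forall`)
* `A` discrete (torsion)  ↦ `τ : ContinuousRep G ℤ A`, `[DiscreteTopology A]` ↦ `(cofreeTorsionGaloisModule S ρ 0).restrictField ℚ_w`
* injectivity half        ↦ `exists_resLe_eq_zero_of_resLe_eq_zero`  ↦ kernel criterion for `jAway` (group direction)
* surjectivity half       ↦ `exists_resLe_eq` (via `exists_isOpen_contOneCocycles_extension` + `exists_le_of_isOpen`) ↦ exhaustion of `Dloc w`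
* coefficient direction   ↦ `exists_forall_mem_torsionBy`            ↦ values in `A_ρ[2^k]` (compose with the frame's `cofreeTorsionIncl`)
* glue                    ↦ `addMonoidHom_ext_of_exhaust`, `exists_addMonoidHom_of_directed` ↦ uniqueness / existence of `locdS x w c`

Ports: §1 (B) is `ZpExtension.exists_resLe_layerSubgroup_eq_zero` (p? `IwasawaH1ReductionInfty`) with `κ.layerSubgroup`
replaced by an abstract open antitone tower; §1 (C) is `UniversalToricDescentResidualSelmerLocal.exists_isOpen_resOfLe_eq` with
`[Finite M]` + `[NumberField K]` replaced by «`H` closed, `A` any discrete module» (finite RANGE of the cocycle instead of finite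
module) over an abstract profinite `G`; the compactness step is `exists_subset_nhds_of_compactSpace` as in both.
-/

set_option autoImplicit false
set_option linter.dupNamespace false

noncomputable section

open scoped Topology Classical
open Field Filter

namespace Summit.BirchSwinnertonDyer.BirchSwinnertonDyer.Cruxes.ResidualThetaCountLowerPureAtTwo.SideaK2G17

open Literature.NumberTheory.GaloisRepresentations Literature.NumberTheory.EllipticCurves

universe u

/-! ## §1 Continuity of `H¹` along a decreasing tower of open subgroups of a profinite group (generic) -/

section Generic

variable {G : Type u} [Group G] [TopologicalSpace G] [IsTopologicalGroup G] [CompactSpace G]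
variable {A : Type u} [AddCommGroup A] [TopologicalSpace A] [DiscreteTopology A]
variable (τ : ContinuousRep G ℤ A)
variable (T : ℕ → Subgroup G) (hT : Antitone T) (hTo : ∀ n, IsOpen (T n : Set G))
variable (H : Subgroup G) (hle : ∀ n, H ≤ T n) (hH : ∀ g : G, (∀ n, g ∈ T n) → g ∈ H)

attribute [local instance] compactSpace_of_isClosed_subgroup

include hle hH in
omit [TopologicalSpace G] [IsTopologicalGroup G] [CompactSpace G] in
/-- `H = ⋂ₙ Tₙ` as a set. [folklore] -/
theorem coe_eq_iInter : (H : Set G) = ⋂ n, (T n : Set G) :=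
  Set.ext fun g ↦ ⟨fun hg ↦ Set.mem_iInter.2 fun n ↦ hle n hg, fun hg ↦ hH g fun n ↦ Set.mem_iInter.1 hg n⟩

include hTo hle hH in
omit [CompactSpace G] in
/-- `H = ⋂ₙ Tₙ` is closed (each open subgroup `Tₙ` is closed). [folklore] -/
theorem isClosed_of_tower : IsClosed (H : Set G) := by
  rw [coe_eq_iInter T H hle hH]
  exact isClosed_iInter fun n ↦ (T n).isClosed_of_isOpen (hTo n)

include hT hTo hH in
/-- **Compactness step**: an open subgroup containing `H = ⋂ₙ Tₙ` contains some `Tₘ`. [folklore] -/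
theorem exists_le_of_isOpen {Ω : Subgroup G} (hΩ : IsOpen (Ω : Set G)) (hHΩ : H ≤ Ω) : ∃ m, T m ≤ Ω := by
  obtain ⟨m, hm⟩ := exists_subset_nhds_of_compactSpace (V := fun m : ℕ ↦ (T m : Set G))
    (fun i j ↦ ⟨max i j, SetLike.coe_subset_coe.2 (hT (le_max_left i j)),
      SetLike.coe_subset_coe.2 (hT (le_max_right i j))⟩)
    (fun m ↦ (T m).isClosed_of_isOpen (hTo m)) (U := (Ω : Set G))
    (fun x hx ↦ hΩ.mem_nhds (hHΩ (hH x fun k ↦ Set.mem_iInter.1 hx k)))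
  exact ⟨m, fun x hx ↦ hm hx⟩

include hT hTo hH in
/-- **(B) Injectivity half of `H¹(H, A) = lim→ₙ H¹(Tₙ, A)` (kernel criterion).**  If `c ∈ H¹(Tₙ, A)` restricts to zero
on `H = ⋂ₘ Tₘ`, then already `res^{Tₙ}_{Tₘ} c = 0` for some `m ≥ n`: writing `c = [φ]`, `φ|_H = ∂a`, the locus `{φ = ∂a} ⊆ Tₙ`
is open and contains `⋂ₘ Tₘ`, hence some `Tₘ` (compactness).  Port of `ZpExtension.exists_resLe_layerSubgroup_eq_zero`.
[cite: SerreGaloisCohomology1997, I §2.2 Prop. 8] -/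
theorem exists_resLe_eq_zero_of_resLe_eq_zero {n : ℕ}
    (c : continuousCohomology 1 (subgroupRep τ.toTopRep (T n))) (hc : resLe τ.toTopRep (hle n) 1 c = 0) :
    ∃ m, ∃ hm : n ≤ m, resLe τ.toTopRep (hT hm) 1 c = 0 := by
  classical
  obtain ⟨φ, rfl⟩ := oneCocycleClass_surjective _ c
  rw [resLe_oneCocycleClass, oneCocycleClass_eq_zero_iff] at hc
  obtain ⟨a, ha⟩ := hc
  have ha' : ∀ (g : G) (hg : g ∈ H), φ.1 ⟨g, hle n hg⟩ = τ g a - a := fun g hg ↦ ha ⟨g, hg⟩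
  -- the open locus `{φ = ∂a}` of `Tₙ`
  let Z : Set (T n) := {x | φ.1 x = τ (x : G) a - a}
  have hZ : IsOpen Z := by
    have h1 : Z = (fun x : T n ↦ φ.1 x - (τ (x : G) a - a)) ⁻¹' {0} := by
      ext x
      simp only [Z, Set.mem_setOf_eq, Set.mem_preimage, Set.mem_singleton_iff, sub_eq_zero]
    rw [h1]
    exact (isOpen_discrete _).preimage (φ.1.continuous.sub
      (((τ.continuous_apply_left a).comp continuous_subtype_val).sub continuous_const))
  have hZ' : IsOpen (Subtype.val '' Z) := (hTo n).isOpenMap_subtype_val Z hZ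
  -- compactness: some `Tₘ` lies in the locus
  obtain ⟨m, hm⟩ := exists_subset_nhds_of_compactSpace (V := fun m : ℕ ↦ (T m : Set G))
    (fun i j ↦ ⟨max i j, SetLike.coe_subset_coe.2 (hT (le_max_left i j)),
      SetLike.coe_subset_coe.2 (hT (le_max_right i j))⟩)
    (fun m ↦ (T m).isClosed_of_isOpen (hTo m)) (U := Subtype.val '' Z) (fun x hx ↦ by
      have hker : x ∈ H := hH x fun k ↦ Set.mem_iInter.1 hx k
      exact hZ'.mem_nhds ⟨⟨x, hle n hker⟩, ha' x hker, rfl⟩)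
  refine ⟨max m n, le_max_right m n, ?_⟩
  rw [resLe_oneCocycleClass, oneCocycleClass_eq_zero_iff]
  refine ⟨a, fun g ↦ ?_⟩
  obtain ⟨x, hxZ, hxg⟩ := hm (hT (le_max_left m n) g.2)
  have hx : x = ⟨(g : G), hT (le_max_right m n) g.2⟩ := Subtype.ext hxg
  subst hx
  exact hxZ

/-- **(C) Extension of a `1`-cocycle from a CLOSED subgroup to an OPEN one.**  `G` profinite, `A` ANY discrete `G`-module
(jointly continuous action), `H ≤ G` closed, `z` a continuous `1`-cocycle of `H`.  Then `z` is the restriction of a continuous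
`1`-cocycle of some open `Ω ⊇ H`: `z` has finitely many values (compact `H`), so some open normal `W ⊴ G` fixes them all and meets
`H` inside the zero locus of `z`; on `Ω = H·W` put `z̃(h w) = z(h)`.  Port of `UniversalToricDescentResidualSelmerLocal.
exists_isOpen_resOfLe_eq` (there: `M` finite, `H` arbitrary, `G = Γ_K` of a number field).
[cite: SerreGaloisCohomology1997, I §2.2 Prop. 8 (proof)] -/
theorem exists_isOpen_contOneCocycles_extension [TotallyDisconnectedSpace G] [IsClosed (H : Set G)]
    (z : contOneCocycles (subgroupRep τ.toTopRep H)) :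
    ∃ Ω : Subgroup G, IsOpen (Ω : Set G) ∧ ∃ hHΩ : H ≤ Ω, ∃ z' : contOneCocycles (subgroupRep τ.toTopRep Ω),
      ∀ x : H, (z'.1 (Subgroup.inclusion hHΩ x) : A) = z.1 x := by
  classical
  have hcont : Continuous fun x : H ↦ (z.1 x : A) := z.1.continuous
  -- (1) finitely many values; their common stabiliser is open
  set vals : Set A := Set.range fun x : H ↦ (z.1 x : A) with hvals
  have hfin : vals.Finite := (isCompact_range hcont).finite_of_discrete
  have hU₁ : IsOpen (⋂ m ∈ vals, {g : G | τ g m = m}) :=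
    hfin.isOpen_biInter fun m _ ↦ τ.isOpen_setOf_apply_eq m
  -- (2) the zero locus of `z` is cut out by an open `V ⊆ G`
  have hzero : IsOpen ((fun x : H ↦ (z.1 x : A)) ⁻¹' {0}) := (isOpen_discrete ({0} : Set A)).preimage hcont
  obtain ⟨V, hV, hVeq⟩ := isOpen_induced_iff.mp hzero
  have h1V : (1 : G) ∈ V := by
    have h1 : (1 : H) ∈ (fun x : H ↦ (z.1 x : A)) ⁻¹' {0} := contOneCocycles.apply_one z
    rw [← hVeq] at h1
    exact h1
  have hVz : ∀ (g : G) (hg : g ∈ H), g ∈ V → (z.1 ⟨g, hg⟩ : A) = 0 := by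
    intro g hg hgV
    have h : (⟨g, hg⟩ : H) ∈ Subtype.val ⁻¹' V := hgV
    rw [hVeq] at h
    exact h
  have h1 : (1 : G) ∈ (⋂ m ∈ vals, {g : G | τ g m = m}) ∩ V :=
    ⟨Set.mem_iInter₂.mpr fun m _ ↦ by
      show τ 1 m = m
      rw [map_one]; rfl, h1V⟩
  -- (3) an open normal subgroup inside both
  obtain ⟨W, hW⟩ := ProfiniteGrp.exist_openNormalSubgroup_sub_open_nhds_of_one (hU₁.inter hV) h1
  set N : Subgroup G := W.toSubgroup with hN
  have hNopen : IsOpen (N : Set G) := W.toOpenSubgroup.isOpen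
  have hNfix : ∀ w ∈ N, ∀ x : H, τ w (z.1 x) = z.1 x := fun w hw x ↦
    (Set.mem_iInter₂.mp (hW hw).1) (z.1 x) ⟨x, rfl⟩
  have hNz : ∀ (g : G) (hg : g ∈ H), g ∈ N → (z.1 ⟨g, hg⟩ : A) = 0 := fun g hg hgN ↦ hVz g hg (hW hgN).2
  -- (4) `Ω = H · N`
  set Ω : Subgroup G := H ⊔ N with hΩ
  have hΩopen : IsOpen (Ω : Set G) := Subgroup.isOpen_mono le_sup_right hNopen
  have hmemΩ : ∀ σ : G, σ ∈ Ω ↔ ∃ h ∈ H, ∃ w ∈ N, h * w = σ := by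
    intro σ
    rw [← SetLike.mem_coe, hΩ, Subgroup.mul_normal H N, Set.mem_mul]
    simp only [SetLike.mem_coe]
  have hzmul : ∀ x x' : H, (z.1 (x * x') : A) = z.1 x + τ (x : G) (z.1 x') := fun x x' ↦ z.2 x x'
  -- (5) `z(h) = z(h')` whenever `h w = h' w'`
  have hwd : ∀ (h h' w w' : G) (hh : h ∈ H) (hh' : h' ∈ H), w ∈ N → w' ∈ N → h * w = h' * w' →
      (z.1 ⟨h, hh⟩ : A) = z.1 ⟨h', hh'⟩ := by
    intro h h' w w' hh hh' hw hw' heq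
    have hq : h⁻¹ * h' = w * w'⁻¹ := by
      calc h⁻¹ * h' = h⁻¹ * (h' * w') * w'⁻¹ := by group
        _ = h⁻¹ * (h * w) * w'⁻¹ := by rw [heq]
        _ = w * w'⁻¹ := by group
    have hqN : h⁻¹ * h' ∈ N := by rw [hq]; exact N.mul_mem hw (N.inv_mem hw')
    have hqH : h⁻¹ * h' ∈ H := H.mul_mem (H.inv_mem hh) hh'
    have e : (⟨h', hh'⟩ : H) = ⟨h, hh⟩ * ⟨h⁻¹ * h', hqH⟩ :=
      Subtype.ext (by rw [Subgroup.coe_mul]; exact (mul_inv_cancel_left h h').symm)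
    rw [e, hzmul, hNz _ hqH hqN, map_zero, add_zero]
  -- (6) representatives and the extended function
  have hrepex : ∀ σ : Ω, ∃ h : G, h ∈ H ∧ ∃ w ∈ N, h * w = σ := fun σ ↦ by
    obtain ⟨h, hh, w, hw, e⟩ := (hmemΩ σ).mp σ.2
    exact ⟨h, hh, w, hw, e⟩
  choose rep hrepH wrep hwrepN hrepeq using hrepex
  let f : Ω → A := fun σ ↦ z.1 ⟨rep σ, hrepH σ⟩
  have hfval : ∀ (σ : Ω) (h w : G) (hh : h ∈ H), w ∈ N → h * w = (σ : G) → f σ = z.1 ⟨h, hh⟩ := by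
    intro σ h w hh hw e
    exact hwd (rep σ) h (wrep σ) w (hrepH σ) hh (hwrepN σ) hw ((hrepeq σ).trans e.symm)
  have hfloc : IsLocallyConstant f := by
    rw [IsLocallyConstant.iff_exists_open]
    intro σ₀
    refine ⟨{σ : Ω | ((σ₀ : G))⁻¹ * (σ : G) ∈ N}, ?_, ?_, ?_⟩
    · exact hNopen.preimage (continuous_const.mul continuous_subtype_val)
    · change ((σ₀ : G))⁻¹ * (σ₀ : G) ∈ N
      rw [inv_mul_cancel]; exact N.one_mem
    · intro σ hσ
      refine hfval σ (rep σ₀) (wrep σ₀ * (((σ₀ : G))⁻¹ * σ)) (hrepH σ₀) (N.mul_mem (hwrepN σ₀) hσ) ?_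
      rw [← mul_assoc, hrepeq σ₀, mul_inv_cancel_left]
  have hfmul : ∀ σ ν : Ω, f (σ * ν) = f σ + τ (σ : G) (f ν) := by
    intro σ ν
    have hconj : (rep ν)⁻¹ * wrep σ * rep ν ∈ N := by
      have := Subgroup.Normal.conj_mem inferInstance (wrep σ) (hwrepN σ) (rep ν)⁻¹
      rwa [inv_inv] at this
    have e : rep σ * rep ν * ((rep ν)⁻¹ * wrep σ * rep ν * wrep ν) = ((σ * ν : Ω) : G) := by
      rw [Subgroup.coe_mul, ← hrepeq σ, ← hrepeq ν]; group
    rw [hfval (σ * ν) (rep σ * rep ν) _ (H.mul_mem (hrepH σ) (hrepH ν)) (N.mul_mem hconj (hwrepN ν)) e]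
    have e2 : (⟨rep σ * rep ν, H.mul_mem (hrepH σ) (hrepH ν)⟩ : H) = ⟨rep σ, hrepH σ⟩ * ⟨rep ν, hrepH ν⟩ :=
      Subtype.ext rfl
    rw [e2, hzmul]
    change (z.1 ⟨rep σ, hrepH σ⟩ : A) + τ (rep σ) (z.1 ⟨rep ν, hrepH ν⟩) =
      z.1 ⟨rep σ, hrepH σ⟩ + τ (σ : G) (z.1 ⟨rep ν, hrepH ν⟩)
    congr 1
    conv_rhs => rw [← hrepeq σ, map_mul, Module.End.mul_apply, hNfix (wrep σ) (hwrepN σ)]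
  let zΩ : contOneCocycles (subgroupRep τ.toTopRep Ω) := ⟨⟨f, hfloc.continuous⟩, fun σ ν ↦ hfmul σ ν⟩
  refine ⟨Ω, hΩopen, le_sup_left, zΩ, fun x ↦ ?_⟩
  change f (Subgroup.inclusion (le_sup_left : H ≤ Ω) x) = z.1 x
  have hx : (x : G) * 1 = ((Subgroup.inclusion (le_sup_left : H ≤ Ω) x : Ω) : G) := by rw [mul_one]; rfl
  rw [hfval _ (x : G) 1 x.2 N.one_mem hx]

include hT hTo hle hH in
/-- **(C′) Surjectivity half of `H¹(H, A) = lim→ₙ H¹(Tₙ, A)` (exhaustion).**  Every class of `H¹(⋂ₙ Tₙ, A)` is restricted from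
some `H¹(Tₘ, A)` — (C) + the compactness step.  [cite: SerreGaloisCohomology1997, I §2.2 Prop. 8] -/
theorem exists_resLe_eq [TotallyDisconnectedSpace G] (x : continuousCohomology 1 (subgroupRep τ.toTopRep H)) :
    ∃ (m : ℕ) (y : continuousCohomology 1 (subgroupRep τ.toTopRep (T m))), resLe τ.toTopRep (hle m) 1 y = x := by
  classical
  haveI : IsClosed (H : Set G) := isClosed_of_tower T hTo H hle hH
  obtain ⟨z, rfl⟩ := oneCocycleClass_surjective _ x
  obtain ⟨Ω, hΩ, hHΩ, z', hz'⟩ := exists_isOpen_contOneCocycles_extension τ H z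
  obtain ⟨m, hm⟩ := exists_le_of_isOpen T hT hTo H hH hΩ hHΩ
  refine ⟨m, resLe τ.toTopRep hm 1 (oneCocycleClass _ z'), ?_⟩
  rw [resLe_oneCocycleClass, resLe_oneCocycleClass]
  congr 1
  apply Subtype.ext
  ext s
  rw [contOneCocycles.pullback_apply, contOneCocycles.pullback_apply]
  exact hz' s

include hT hTo hle hH in
/-- (C″) The same with a FLOOR: the level `m` can be taken `≥ n₀` (push along `res^{Tₘ}_{T_{max m n₀}}`).
[cite: SerreGaloisCohomology1997, I §2.2 Prop. 8] -/
theorem exists_resLe_eq_of_le [TotallyDisconnectedSpace G] (n₀ : ℕ) (x : continuousCohomology 1 (subgroupRep τ.toTopRep H)) :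
    ∃ m, n₀ ≤ m ∧ ∃ y : continuousCohomology 1 (subgroupRep τ.toTopRep (T m)), resLe τ.toTopRep (hle m) 1 y = x := by
  obtain ⟨m, y, rfl⟩ := exists_resLe_eq τ T hT hTo H hle hH x
  exact ⟨max m n₀, le_max_right m n₀, resLe τ.toTopRep (hT (le_max_left m n₀)) 1 y,
    resLe_resLe_apply τ.toTopRep (hle (max m n₀)) (hT (le_max_left m n₀)) y⟩

include hT hTo in
/-- (C‴) The literal `⨅` form (the shape RESERVED by w2 g19 for `Theorems/…ProfiniteOneCocycleExtension.lean`, bus 04:55:18Z):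
every class of `H¹(⨅ₙ Tₙ, A)` is `res` of a class of some `H¹(Tₘ, A)`.  [cite: SerreGaloisCohomology1997, I §2.2 Prop. 8] -/
theorem exists_resLe_eq_of_iInf [TotallyDisconnectedSpace G] (x : continuousCohomology 1 (subgroupRep τ.toTopRep (⨅ n, T n))) :
    ∃ (m : ℕ) (y : continuousCohomology 1 (subgroupRep τ.toTopRep (T m))), resLe τ.toTopRep (iInf_le T m) 1 y = x :=
  exists_resLe_eq τ T hT hTo (⨅ n, T n) (fun n ↦ iInf_le T n) (fun _ hg ↦ Subgroup.mem_iInf.2 hg) x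

include hT hTo in
/-- (B′) The literal `⨅` form of the kernel criterion. [cite: SerreGaloisCohomology1997, I §2.2 Prop. 8] -/
theorem exists_resLe_eq_zero_of_resLe_iInf_eq_zero {n : ℕ} (c : continuousCohomology 1 (subgroupRep τ.toTopRep (T n)))
    (hc : resLe τ.toTopRep (iInf_le T n) 1 c = 0) : ∃ m, ∃ hm : n ≤ m, resLe τ.toTopRep (hT hm) 1 c = 0 :=
  exists_resLe_eq_zero_of_resLe_eq_zero τ T hT hTo (⨅ n, T n) (fun n ↦ iInf_le T n) (fun _ hg ↦ Subgroup.mem_iInf.2 hg) c hc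

omit [IsTopologicalGroup G] in
/-- **(D) Coefficient direction.**  A continuous `1`-cocycle of a compact group with values in a discrete module all of whose
elements are `r`-power torsion takes values in ONE `A[r^k]` (finitely many values).  With `r = 2`, `A = A_ρ` this puts a level
cocycle into the image of the frame's `cofreeTorsionIncl k : A_ρ[2^k] ↪ A_ρ`.  [cite: SerreGaloisCohomology1997, I §2.2] -/
theorem exists_forall_mem_torsionBy (r : ℤ) (hr : ∀ a : A, ∃ n : ℕ, r ^ n • a = 0) (S : Subgroup G) [IsClosed (S : Set G)]
    (z : contOneCocycles (subgroupRep τ.toTopRep S)) :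
    ∃ k : ℕ, ∀ x : S, (z.1 x : A) ∈ AddSubgroup.torsionBy A (r ^ k) := by
  haveI : DiscreteTopology (subgroupRep τ.toTopRep S) := ‹DiscreteTopology A›
  obtain ⟨k, hk⟩ := BigGaloisRep.contOneCocycles.exists_pow_smul_apply_eq_zero (subgroupRep τ.toTopRep S) r hr z
  exact ⟨k, fun x ↦ (Submodule.mem_torsionBy_iff (R := ℤ) _ _).mpr (hk x)⟩

end Generic

/-! ## §2 The local layer tower of the frame: `U_n = layerGroup κ v n ↘ U_∞ = localSubgroupOfEmb κ.kerSubgroup (closureEmb ℚ_v)` -/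

section LocalTower

open NumberField IsDedekindDomain Literature.NumberTheory.EllipticCurves.CyclotomicLayer
  Literature.NumberTheory.EllipticCurves.Kato2004

attribute [local instance] absoluteGaloisGroup_compactSpace

variable {p : ℕ} [Fact p.Prime] (κ : ZpExtension ℚ p) (v : HeightOneSpectrum (𝓞 ℚ))
variable {M : Type} [AddCommGroup M] [TopologicalSpace M] [DiscreteTopology M] (ρM : DiscreteGaloisModule ℚ M)

/-- `⋂ₙ Γₙ = Γ_∞` as subgroups. [cite: SerreGaloisCohomology1997, I §2.2] -/
theorem kerSubgroup_eq_iInf : κ.kerSubgroup = ⨅ n, κ.layerSubgroup n :=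
  le_antisymm (le_iInf fun n ↦ κ.kerSubgroup_le_layerSubgroup n)
    fun _ hg ↦ κ.mem_kerSubgroup_of_forall_mem_layerSubgroup fun m ↦ Subgroup.mem_iInf.1 hg m

/-- `U_∞ ≤ U_n` (frame §1, line 1). [cite: Kato2004Asterisque, §12.2 (p. 220)] -/
theorem uInf_le_layerGroup (n : ℕ) :
    localSubgroupOfEmb κ.kerSubgroup (closureEmb (K := ℚ) (v.adicCompletion ℚ)) ≤ layerGroup κ v n :=
  Subgroup.comap_mono (κ.kerSubgroup_le_layerSubgroup n)

/-- `⋂ₙ U_n ≤ U_∞`: membership in every local layer group forces membership in `U_∞`. [cite: SerreGaloisCohomology1997, I §2.2] -/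
theorem mem_uInf_of_forall (g : absoluteGaloisGroup (v.adicCompletion ℚ)) (hg : ∀ n, g ∈ layerGroup κ v n) :
    g ∈ localSubgroupOfEmb κ.kerSubgroup (closureEmb (K := ℚ) (v.adicCompletion ℚ)) :=
  κ.mem_kerSubgroup_of_forall_mem_layerSubgroup fun n ↦ hg n

/-- `U_∞ = ⨅ₙ U_n` as subgroups of `Γ_{ℚ_v}`. [cite: SerreGaloisCohomology1997, I §2.2] -/
theorem uInf_eq_iInf_layerGroup :
    localSubgroupOfEmb κ.kerSubgroup (closureEmb (K := ℚ) (v.adicCompletion ℚ)) = ⨅ n, layerGroup κ v n :=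
  le_antisymm (le_iInf fun n ↦ uInf_le_layerGroup κ v n)
    fun g hg ↦ mem_uInf_of_forall κ v g fun n ↦ Subgroup.mem_iInf.1 hg n

/-- **Kernel criterion for the local tower** (injectivity half of `H¹(ℚ_{∞,ṽ}, M) = lim→ₙ H¹(ℚ_{n,v}, M)`): a class of
`H¹(U_n, M|)` dying on `U_∞` dies on some `U_m`, `m ≥ n`.  [cite: SerreGaloisCohomology1997, I §2.2 Prop. 8] -/
theorem localTower_exists_resLe_eq_zero {n : ℕ} (c : continuousCohomology 1 (subgroupRep (localRepOf ρM v) (layerGroup κ v n)))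
    (hc : resLe (localRepOf ρM v) (uInf_le_layerGroup κ v n) 1 c = 0) :
    ∃ m, ∃ hm : n ≤ m, resLe (localRepOf ρM v) (layerGroup_antitone κ v hm) 1 c = 0 :=
  exists_resLe_eq_zero_of_resLe_eq_zero (GaloisRep.restrictField (v.adicCompletion ℚ) ρM) (layerGroup κ v)
    (layerGroup_antitone κ v) (isOpen_layerGroup κ v) _ (uInf_le_layerGroup κ v) (mem_uInf_of_forall κ v) c hc

/-- **Exhaustion of `H¹(U_∞, M|)` by the layers, from any floor `n₀`** (surjectivity half): every class of `H¹(U_∞, M|)` is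
`res` of a class of `H¹(U_m, M|)` with `m ≥ n₀`.  With `M = A_ρ` (`cofreeTorsionGaloisModule S ρ 0`) and `n₀ = nfl w` this is the
group direction of «`Dloc w` is exhausted by the `jAway w n k` images»; the coefficient direction is `exists_forall_mem_torsionBy`.
[cite: SerreGaloisCohomology1997, I §2.2 Prop. 8] -/
theorem localTower_exists_resLe_eq (n₀ : ℕ)
    (x : continuousCohomology 1 (subgroupRep (localRepOf ρM v) (localSubgroupOfEmb κ.kerSubgroup (closureEmb (K := ℚ) (v.adicCompletion ℚ))))) :
    ∃ m, n₀ ≤ m ∧ ∃ y : continuousCohomology 1 (subgroupRep (localRepOf ρM v) (layerGroup κ v m)),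
      resLe (localRepOf ρM v) (uInf_le_layerGroup κ v m) 1 y = x := by
  haveI : TotallyDisconnectedSpace (absoluteGaloisGroup (v.adicCompletion ℚ)) := by
    change TotallyDisconnectedSpace (AlgebraicClosure (v.adicCompletion ℚ) ≃ₐ[v.adicCompletion ℚ] AlgebraicClosure (v.adicCompletion ℚ))
    infer_instance
  exact exists_resLe_eq_of_le (GaloisRep.restrictField (v.adicCompletion ℚ) ρM) (layerGroup κ v)
    (layerGroup_antitone κ v) (isOpen_layerGroup κ v) _ (uInf_le_layerGroup κ v) (mem_uInf_of_forall κ v) n₀ x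

end LocalTower

/-! ## §2b Coefficient direction on the frame's module `A_ρ = A_ρ[0]` (`cofreeTorsionGaloisModule S ρ 0`, any prime `p`) -/

section Coefficients

open NumberField IsDedekindDomain Literature.NumberTheory.EllipticCurves.CyclotomicLayer
  Literature.NumberTheory.EllipticCurves.GreenbergSelmer Literature.NumberTheory.EllipticCurves.Kato2004

attribute [local instance] absoluteGaloisGroup_compactSpace compactSpace_of_isClosed_subgroup

variable {p : ℕ} [Fact p.Prime] (S : Set (PadicAlgCl p)) {d : ℕ} (ρ : FramedGaloisRep ℚ ↥(padicCoeffIntegers S) d)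
  (κ : ZpExtension ℚ p) (v : HeightOneSpectrum (𝓞 ℚ))

/-- `A_ρ[0] = A_ρ` is `p`-primary as a `ℤ`-module (from `GreenbergSelmer.exists_pow_smul_cofree_eq_zero`). [cite: Greenberg1989, §1 p. 98] -/
theorem torsionByZero_pPrimary (a : ↥(AddSubgroup.torsionBy (Cofree ρ ↥(padicCoeffField S)) 0)) :
    ∃ j : ℕ, (p : ℤ) ^ j • a = 0 := by
  obtain ⟨j, hj⟩ := exists_pow_smul_cofree_eq_zero S ρ (a : Cofree ρ ↥(padicCoeffField S))
  refine ⟨j, Subtype.ext ?_⟩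
  rw [AddSubgroupClass.coe_zsmul, ZeroMemClass.coe_zero, ← Nat.cast_pow, natCast_zsmul]
  exact hj

/-- **Coefficient direction for the frame's `Dlev → Dloc`**: a continuous `1`-cocycle of the local layer group `U_n = layerGroup κ v n`
with values in `A_ρ = A_ρ[0]` takes all its values in ONE finite layer `A_ρ[p^k]` — so its class is in the image of
`(cofreeTorsionIncl k)_* : H¹(U_n, A_ρ[p^k]) → H¹(U_n, A_ρ)` (frame file (b)).  With (C′) this is the exhaustion of `Dloc w` by the
`jAway w n k` images.  [cite: SerreGaloisCohomology1997, I §2.2 Prop. 8] [cite: Greenberg1989, §1 p. 98] -/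
theorem layerCocycle_exists_forall_mem_torsionBy (n : ℕ)
    (z : contOneCocycles (subgroupRep (localRepOf (cofreeTorsionGaloisModule S ρ 0) v) (layerGroup κ v n))) :
    ∃ k : ℕ, ∀ x : layerGroup κ v n,
      ((z.1 x : ↥(AddSubgroup.torsionBy (Cofree ρ ↥(padicCoeffField S)) 0)) : Cofree ρ ↥(padicCoeffField S)) ∈
        AddSubgroup.torsionBy (Cofree ρ ↥(padicCoeffField S)) ((p ^ k : ℕ) : ℤ) := by
  haveI := (layerGroup κ v n).isClosed_of_isOpen (isOpen_layerGroup κ v n)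
  obtain ⟨k, hk⟩ := exists_forall_mem_torsionBy
    (GaloisRep.restrictField (v.adicCompletion ℚ) (cofreeTorsionGaloisModule S ρ 0)) (p : ℤ) (torsionByZero_pPrimary S ρ)
    (layerGroup κ v n) z
  refine ⟨k, fun x ↦ (Submodule.mem_torsionBy_iff (R := ℤ) _ _).mpr ?_⟩
  have hx := (Submodule.mem_torsionBy_iff (R := ℤ) _ _).mp (hk x)
  rw [Nat.cast_pow, ← AddSubgroupClass.coe_zsmul, hx, ZeroMemClass.coe_zero]

/-- `A_ρ = Cofree ρ F` is `p`-primary as a `ℤ`-module (integer powers; from `GreenbergSelmer.exists_pow_smul_cofree_eq_zero`). [cite: Greenberg1989, §1 p. 98] -/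
theorem cofree_pPrimary_int (a : Cofree ρ ↥(padicCoeffField S)) : ∃ j : ℕ, (p : ℤ) ^ j • a = 0 := by
  obtain ⟨j, hj⟩ := exists_pow_smul_cofree_eq_zero S ρ a
  exact ⟨j, by rw [← Nat.cast_pow, natCast_zsmul]; exact hj⟩

/-- **Coefficient direction on the CARRIER OF RECORD** (LEAD rtt-p2 g18, bus 04:56:41Z: `Dloc S κ ρ w := continuousCohomology 1 (subgroupRep
(localRepOf (cofreeGaloisModule S ρ) w) (kerGroup κ w))` with the FULL module `Cofree ρ F`): for ANY discrete-Galois-module structure `ρA` on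
`A_ρ = Cofree ρ F` (e.g. the announced `cofreeGaloisModule S ρ`) and any closed `U ≤ Γ_{ℚ_v}` (e.g. `kerGroup κ w`, `layerGroup κ w n`), a continuous
`1`-cocycle `U → A_ρ` takes all its values in ONE `A_ρ[p^k]` — so its class is `(cofreeTorsionInclusion k)_*` of a class with finite coefficients.
[cite: SerreGaloisCohomology1997, I §2.2 Prop. 8] [cite: Greenberg1989, §1 p. 98] -/
theorem cofreeCocycle_exists_forall_mem_torsionBy (ρA : DiscreteGaloisModule ℚ (Cofree ρ ↥(padicCoeffField S)))
    (U : Subgroup (absoluteGaloisGroup (v.adicCompletion ℚ))) [IsClosed (U : Set (absoluteGaloisGroup (v.adicCompletion ℚ)))]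
    (z : contOneCocycles (subgroupRep (localRepOf ρA v) U)) :
    ∃ k : ℕ, ∀ x : U, (z.1 x : Cofree ρ ↥(padicCoeffField S)) ∈ AddSubgroup.torsionBy (Cofree ρ ↥(padicCoeffField S)) ((p ^ k : ℕ) : ℤ) := by
  obtain ⟨k, hk⟩ := exists_forall_mem_torsionBy (GaloisRep.restrictField (v.adicCompletion ℚ) ρA) (p : ℤ) (cofree_pPrimary_int S ρ) U z
  exact ⟨k, fun x ↦ by rw [Nat.cast_pow]; exact hk x⟩

/-- The frame's `U_∞ = kerGroup κ w := localSubgroupOfEmb κ.kerSubgroup (closureEmb ℚ_w)` is closed (so the corollary above applies to `Dloc`).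
[cite: SerreGaloisCohomology1997, I §2.2] -/
theorem isClosed_uInf :
    IsClosed ((localSubgroupOfEmb κ.kerSubgroup (closureEmb (K := ℚ) (v.adicCompletion ℚ)) :
      Subgroup (absoluteGaloisGroup (v.adicCompletion ℚ))) : Set (absoluteGaloisGroup (v.adicCompletion ℚ))) := by
  rw [uInf_eq_iInf_layerGroup κ v, Subgroup.coe_iInf]
  exact isClosed_iInter fun n ↦ (layerGroup κ v n).isClosed_of_isOpen (isOpen_layerGroup κ v n)

end Coefficients

/-! ## §3 The character glue: a compatible directed family of level characters on an exhausted group is ONE character -/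

section Glue

variable {ι : Type*} [Preorder ι] [IsDirected ι (· ≤ ·)] {D : ι → Type*} [∀ i, AddCommGroup (D i)]
  {L T : Type*} [AddCommGroup L] [AddCommGroup T]
  (t : ∀ i i', i ≤ i' → D i →+ D i') (j : ∀ i, D i →+ L) (χ : ∀ i, D i →+ T)
  (hjt : ∀ i i' (h : i ≤ i') (x : D i), j i' (t i i' h x) = j i x)
  (hχt : ∀ i i' (h : i ≤ i') (x : D i), χ i' (t i i' h x) = χ i x)
  (hex : ∀ y : L, ∃ i, ∃ x : D i, j i x = y)
  (hker : ∀ i (x : D i), j i x = 0 → ∃ i', ∃ h : i ≤ i', t i i' h x = 0)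

include hex in
omit [Preorder ι] [IsDirected ι (· ≤ ·)] in
/-- **Uniqueness**: two characters of `L` agreeing on every level image are equal (`L` exhausted by the `j i`).  This is the
frame's «two candidates for `locdS x w c` agreeing on every `jAway w n k y` coincide». [folklore] -/
theorem addMonoidHom_ext_of_exhaust {Χ Χ' : L →+ T}
    (h : ∀ i (x : D i), Χ (j i x) = Χ' (j i x)) : Χ = Χ' := by
  ext y
  obtain ⟨i, x, rfl⟩ := hex y
  exact h i x

include hjt hχt hker in
/-- Compatibility of the level characters on equal images, from (P) `hχt` + (K) the kernel criterion `hker`. [folklore] -/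
theorem apply_eq_of_eq {i i' : ι} (x : D i) (x' : D i') (he : j i x = j i' x') : χ i x = χ i' x' := by
  obtain ⟨i₀, hi, hi'⟩ := exists_ge_ge i i'
  have h0 : j i₀ (t i i₀ hi x - t i' i₀ hi' x') = 0 := by rw [map_sub, hjt, hjt, he, sub_self]
  obtain ⟨i₁, h₁, hz⟩ := hker i₀ _ h0
  have h2 : χ i₁ (t i₀ i₁ h₁ (t i i₀ hi x - t i' i₀ hi' x')) = 0 := by rw [hz, map_zero]
  rw [hχt, map_sub, hχt, hχt, sub_eq_zero] at h2
  exact h2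

include hjt hχt hex hker in
/-- **Existence**: the level characters glue to ONE character `Χ : L →+ T` with `Χ ∘ j i = χ i` — the frame's EXISTENCE of
`locdS x w c` on `Dloc w` from the pinned level values (`hlocdS`), given exhaustion (C′/C″ + D) and the kernel criterion (B).
(Equivalently: `L` is the direct limit of the `D i` and `Χ = DirectLimit.lift χ`.) [folklore] -/
theorem exists_addMonoidHom_of_directed : ∃ Χ : L →+ T, ∀ i (x : D i), Χ (j i x) = χ i x := by
  classical
  choose idx pre hpre using hex
  have hc := fun {i i' : ι} (x : D i) (x' : D i') (he : j i x = j i' x') ↦ apply_eq_of_eq t j χ hjt hχt hker x x' he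
  refine ⟨AddMonoidHom.mk' (fun y ↦ χ (idx y) (pre y)) fun y₁ y₂ ↦ ?_, fun i x ↦ hc _ _ (hpre _)⟩
  obtain ⟨i₀, h₁, h₂⟩ := exists_ge_ge (idx y₁) (idx y₂)
  have hsum : j i₀ (t _ i₀ h₁ (pre y₁) + t _ i₀ h₂ (pre y₂)) = y₁ + y₂ := by rw [map_add, hjt, hjt, hpre, hpre]
  change χ (idx (y₁ + y₂)) (pre (y₁ + y₂)) = χ (idx y₁) (pre y₁) + χ (idx y₂) (pre y₂)
  rw [hc (pre (y₁ + y₂)) (t _ i₀ h₁ (pre y₁) + t _ i₀ h₂ (pre y₂)) (by rw [hpre, hsum]), map_add, hχt, hχt]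

include hjt hχt hex hker in
/-- Existence and uniqueness together. [folklore] -/
theorem existsUnique_addMonoidHom_of_directed : ∃! Χ : L →+ T, ∀ i (x : D i), Χ (j i x) = χ i x := by
  obtain ⟨Χ, hΧ⟩ := exists_addMonoidHom_of_directed t j χ hjt hχt hex hker
  exact ⟨Χ, hΧ, fun Χ' hΧ' ↦ addMonoidHom_ext_of_exhaust j hex fun i x ↦ (hΧ' i x).trans (hΧ i x).symm⟩

end Glue

end Summit.BirchSwinnertonDyer.BirchSwinnertonDyer.Cruxes.ResidualThetaCountLowerPureAtTwo.SideaK2G17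

end
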